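import Summits.QuantumAdvantage.QuantumAdvantage.Theorems.DigitRung.Negative.WalshAndIndependence
import Literature.NumberTheory.Sieve.VinogradovExpSumTools
import Literature.NumberTheory.Sieve.RamanujanSum
import Literature.Computability.Complexity.WalshDyadicFourier

/-!
# `DigitRung` (stmt-QuantumAdvantage-2423) — line `Sketch`, stub `stub_fourier`

The exact finite Fourier expansion of the digit square wave `w_j(d) = (−1)^{bit_j d}` on
`ℤ/2^{j+1}`: with `q = 2^{j+1}`, `H = 2^j` and `e(x) = exp(2πix)`,

  `w_j(d) = Σ_{r<q} c_r e(d r/q)`,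
  `c_r = q⁻¹ Σ_{x<q} w_j(x) e(−x r/q) = q⁻¹ (1 − e(−rH/q)) Σ_{x<H} e(−x r/q)`,

so `c_r = 0` for even `r` (`e(−rH/q) = e(−r/2) = 1`), while for odd `r` the geometric sum gives
`|c_r| = 4/(q |e(−r/q) − 1|) ≤ 1/min(r, q − r)` (`|e(θ) − 1| = 2|sin πθ| ≥ 4‖θ‖`), whence
`Σ_r |c_r| ≤ Σ_{0<r<q} 1/min(r, q−r) ≤ 2(1 + log q) ≤ 4(j+1)`.
Pure finite Fourier analysis (Mathlib's `Real.fourierChar`, the tree's geometric-sum tools).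
-/

noncomputable section

namespace Summit.QuantumAdvantage.DigitRung.Sketch

open scoped Classical FourierTransform
open Filter Finset
open Summit.QuantumAdvantage.DigitRung.Negative

namespace StubFourier

open Literature.NumberTheory.Sieve.Vinogradov (distInt distInt_neg two_mul_distInt_le_abs_sin
  norm_fourierChar_sub_one fourierChar_natCast_mul)
open Literature.NumberTheory.Sieve.RamanujanSum (fourierChar_intCast sum_range_fourierChar_div)
open Literature.Computability.Complexity.WalshDyadic (distInt_natCast_div sum_Ioo_inv_min_le)

/-! ### The digit sign as a function on `ℤ/2^{j+1}` -/

/-- The digit sign `w_j(d)` depends only on `d mod 2^{j+1}`. [folklore] -/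
theorem walshSign_mod (j d : ℕ) : walshSign j (d % 2 ^ (j + 1)) = walshSign j d := by
  unfold walshSign
  rw [Nat.testBit_mod_two_pow]
  simp

/-- `w_j(x) = 1` for `x < 2^j`. [folklore] -/
theorem walshSign_of_lt {j x : ℕ} (hx : x < 2 ^ j) : walshSign j x = 1 := by
  unfold walshSign
  rw [Nat.testBit_lt_two_pow hx]
  simp

/-- `w_j(2^j + x) = -1` for `x < 2^j`. [folklore] -/
theorem walshSign_two_pow_add {j x : ℕ} (hx : x < 2 ^ j) : walshSign j (2 ^ j + x) = -1 := by
  unfold walshSign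
  rw [Nat.testBit_two_pow_add_eq, Nat.testBit_lt_two_pow hx]
  simp

/-- Splitting the period into its two halves:
`Σ_{x < 2^{j+1}} w_j(x) ζ^x = (1 − ζ^{2^j}) Σ_{x < 2^j} ζ^x`. [folklore] -/
theorem sum_walshSign_mul_pow (j : ℕ) (ζ : ℂ) :
    ∑ x ∈ range (2 ^ (j + 1)), ((walshSign j x : ℝ) : ℂ) * ζ ^ x =
      (1 - ζ ^ 2 ^ j) * ∑ x ∈ range (2 ^ j), ζ ^ x := by
  have hq : 2 ^ (j + 1) = 2 ^ j + 2 ^ j := by ring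
  rw [hq, Finset.sum_range_add]
  have h1 : ∑ x ∈ range (2 ^ j), ((walshSign j x : ℝ) : ℂ) * ζ ^ x = ∑ x ∈ range (2 ^ j), ζ ^ x :=
    Finset.sum_congr rfl fun x hx => by
      rw [walshSign_of_lt (mem_range.mp hx), Complex.ofReal_one, one_mul]
  have h2 : ∑ x ∈ range (2 ^ j), ((walshSign j (2 ^ j + x) : ℝ) : ℂ) * ζ ^ (2 ^ j + x) =
      -(ζ ^ 2 ^ j * ∑ x ∈ range (2 ^ j), ζ ^ x) := by
    rw [Finset.mul_sum, ← Finset.sum_neg_distrib]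
    refine Finset.sum_congr rfl fun x hx => ?_
    rw [walshSign_two_pow_add (mem_range.mp hx), pow_add, Complex.ofReal_neg, Complex.ofReal_one]
    ring
  rw [h1, h2]
  ring

/-! ### The characters `e(-r/2)` and `e(-r/2^{j+1})^{2^j}` -/

/-- `e(−r/2) = −1` for odd `r` and `= 1` for even `r`. [folklore] -/
theorem fourierChar_neg_half (r : ℕ) :
    (𝐞 (-((r : ℝ) / 2)) : ℂ) = if Odd r then -1 else 1 := by
  split_ifs with hr
  · obtain ⟨k, rfl⟩ := hr
    rw [show -(((2 * k + 1 : ℕ) : ℝ) / 2) = ((-((k : ℤ) + 1) : ℤ) : ℝ) + 1 / 2 by push_cast; ring,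
      AddChar.map_add_eq_mul, Circle.coe_mul, fourierChar_intCast, one_mul, Real.fourierChar_apply,
      show (((2 * Real.pi * (1 / 2) : ℝ)) : ℂ) = (Real.pi : ℂ) by push_cast; ring]
    exact Complex.exp_pi_mul_I
  · obtain ⟨k, rfl⟩ := Nat.not_odd_iff_even.mp hr
    rw [show -(((k + k : ℕ) : ℝ) / 2) = ((-(k : ℤ) : ℤ) : ℝ) by push_cast; ring]
    exact fourierChar_intCast _

/-- `e(−r/2^{j+1})^{2^j} = e(−r/2) = ∓1` according as `r` is odd or even. [folklore] -/
theorem fourierChar_pow_two_pow (j r : ℕ) :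
    (𝐞 (-((r : ℝ) / 2 ^ (j + 1))) : ℂ) ^ 2 ^ j = if Odd r then -1 else 1 := by
  have h : ((2 ^ j : ℕ) : ℝ) * -((r : ℝ) / 2 ^ (j + 1)) = -((r : ℝ) / 2) := by
    push_cast
    field_simp
    ring
  rw [← fourierChar_neg_half, ← h, fourierChar_natCast_mul]

/-! ### The Fourier coefficients of the square wave -/

/-- Closed form of the coefficient: `c_r = q⁻¹ (1 − ζ^{2^j}) Σ_{x<2^j} ζ^x` with `ζ = e(−r/q)`,
`q = 2^{j+1}`. [folklore] -/
theorem coef_eq (j : ℕ) (c : ℕ → ℂ)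
    (hc : ∀ r, c r = 1 / (2 ^ (j + 1) : ℂ) * ∑ x ∈ range (2 ^ (j + 1)),
      ((walshSign j x : ℝ) : ℂ) * (𝐞 (-((x : ℝ) * ((r : ℝ) / 2 ^ (j + 1)))) : ℂ)) (r : ℕ) :
    c r = 1 / (2 ^ (j + 1) : ℂ) * ((1 - (𝐞 (-((r : ℝ) / 2 ^ (j + 1))) : ℂ) ^ 2 ^ j) *
      ∑ x ∈ range (2 ^ j), (𝐞 (-((r : ℝ) / 2 ^ (j + 1))) : ℂ) ^ x) := by
  rw [hc, ← sum_walshSign_mul_pow]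
  congr 1
  refine Finset.sum_congr rfl fun x _ => ?_
  rw [← fourierChar_natCast_mul, mul_neg]

/-- The coefficients vanish at even frequencies. [folklore] -/
theorem coef_eq_zero (j : ℕ) (c : ℕ → ℂ)
    (hc : ∀ r, c r = 1 / (2 ^ (j + 1) : ℂ) * ∑ x ∈ range (2 ^ (j + 1)),
      ((walshSign j x : ℝ) : ℂ) * (𝐞 (-((x : ℝ) * ((r : ℝ) / 2 ^ (j + 1)))) : ℂ)) {r : ℕ}
    (hr : ¬ Odd r) : c r = 0 := by
  rw [coef_eq j c hc r, fourierChar_pow_two_pow, if_neg hr, sub_self, zero_mul, mul_zero]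

/-- The coefficient bound at odd frequencies: `|c_r| ≤ 1/min(r, q − r)` for odd `r < q = 2^{j+1}`
(geometric sum and `|e(θ) − 1| = 2|sin πθ| ≥ 4‖θ‖`). [folklore] -/
theorem norm_coef_le (j : ℕ) (c : ℕ → ℂ)
    (hc : ∀ r, c r = 1 / (2 ^ (j + 1) : ℂ) * ∑ x ∈ range (2 ^ (j + 1)),
      ((walshSign j x : ℝ) : ℂ) * (𝐞 (-((x : ℝ) * ((r : ℝ) / 2 ^ (j + 1)))) : ℂ)) {r : ℕ}
    (hr : Odd r) (hrq : r < 2 ^ (j + 1)) :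
    ‖c r‖ ≤ (((min r (2 ^ (j + 1) - r) : ℕ) : ℝ))⁻¹ := by
  obtain ⟨ζ, hζ⟩ : ∃ ζ : ℂ, ζ = (𝐞 (-((r : ℝ) / 2 ^ (j + 1))) : ℂ) := ⟨_, rfl⟩
  obtain ⟨μ, hμ⟩ : ∃ μ : ℕ, μ = min r (2 ^ (j + 1) - r) := ⟨_, rfl⟩
  rw [← hμ]
  have hr0 := hr.pos
  have hμ1 : (1 : ℝ) ≤ μ := by
    have : 1 ≤ μ := by rw [hμ]; exact le_min (by omega) (by omega)
    exact_mod_cast this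
  have hζH : ζ ^ 2 ^ j = -1 := by rw [hζ, fourierChar_pow_two_pow, if_pos hr]
  have hGζ : (∑ x ∈ range (2 ^ j), ζ ^ x) * (ζ - 1) = -2 := by
    rw [geom_sum_mul, hζH]; norm_num
  have hcr : c r = 1 / (2 ^ (j + 1) : ℂ) * (2 * ∑ x ∈ range (2 ^ j), ζ ^ x) := by
    rw [coef_eq j c hc r, ← hζ, hζH]; ring
  have hQC : (2 ^ (j + 1) : ℂ) ≠ 0 := pow_ne_zero _ two_ne_zero
  have hkey : c r * (ζ - 1) * 2 ^ (j + 1) = -4 := by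
    calc c r * (ζ - 1) * 2 ^ (j + 1)
        = 1 / (2 ^ (j + 1) : ℂ) * 2 ^ (j + 1) * 2 *
            ((∑ x ∈ range (2 ^ j), ζ ^ x) * (ζ - 1)) := by rw [hcr]; ring
      _ = -4 := by rw [hGζ, one_div_mul_cancel hQC]; norm_num
  have hnorm : ‖c r‖ * ‖ζ - 1‖ * 2 ^ (j + 1) = 4 := by
    have h := congrArg norm hkey
    simpa [norm_mul, norm_neg, norm_pow] using h
  have hdist : distInt ((r : ℝ) / 2 ^ (j + 1)) * 2 ^ (j + 1) = μ := by
    have h := distInt_natCast_div (M := 2 ^ (j + 1)) (z := r) (by positivity) hrq.le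
    rw [← hμ] at h
    push_cast at h
    rw [h]
    exact div_mul_cancel₀ _ (by positivity)
  have hlow : 4 * (μ : ℝ) ≤ ‖ζ - 1‖ * 2 ^ (j + 1) := by
    rw [hζ, norm_fourierChar_sub_one]
    have hs := two_mul_distInt_le_abs_sin (-((r : ℝ) / 2 ^ (j + 1)))
    rw [distInt_neg] at hs
    have hQ : (0 : ℝ) ≤ 2 ^ (j + 1) := by positivity
    have := mul_le_mul_of_nonneg_right hs hQ
    linarith
  have hfin : ‖c r‖ * μ ≤ 1 := by
    have := mul_le_mul_of_nonneg_left hlow (norm_nonneg (c r))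
    linarith
  have hμpos : (0 : ℝ) < μ := by linarith
  rw [← one_div, le_div_iff₀ hμpos]
  exact hfin

/-- The `L¹` mass of the coefficients: `Σ_{r<2^{j+1}} |c_r| ≤ 4(j+1)`. [folklore] -/
theorem mass_le (j : ℕ) (c : ℕ → ℂ)
    (hc : ∀ r, c r = 1 / (2 ^ (j + 1) : ℂ) * ∑ x ∈ range (2 ^ (j + 1)),
      ((walshSign j x : ℝ) : ℂ) * (𝐞 (-((x : ℝ) * ((r : ℝ) / 2 ^ (j + 1)))) : ℂ)) :
    (∑ r ∈ range (2 ^ (j + 1)), ‖c r‖) ≤ 4 * (j + 1) := by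
  obtain ⟨q, hq⟩ : ∃ q : ℕ, q = 2 ^ (j + 1) := ⟨_, rfl⟩
  rw [← hq]
  have hpt : ∀ r ∈ range q, ‖c r‖ ≤ if r ∈ Ioo 0 q then (((min r (q - r) : ℕ) : ℝ))⁻¹ else 0 := by
    intro r hr
    rw [mem_range] at hr
    by_cases hro : Odd r
    · rw [if_pos (mem_Ioo.mpr ⟨hro.pos, hr⟩), hq]
      exact norm_coef_le j c hc hro (hr.trans_eq hq)
    · rw [coef_eq_zero j c hc hro, norm_zero]
      split_ifs <;> positivity
  calc ∑ r ∈ range q, ‖c r‖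
      ≤ ∑ r ∈ range q, (if r ∈ Ioo 0 q then (((min r (q - r) : ℕ) : ℝ))⁻¹ else 0) :=
        Finset.sum_le_sum hpt
    _ = ∑ r ∈ Ioo 0 q, (((min r (q - r) : ℕ) : ℝ))⁻¹ := by
        rw [← Finset.sum_filter]
        congr 1
        ext r
        simp only [Finset.mem_filter, Finset.mem_range, Finset.mem_Ioo]
        omega
    _ ≤ 2 * (1 + Real.log q) := sum_Ioo_inv_min_le q
    _ ≤ 4 * (j + 1) := by
        have hqR : (q : ℝ) = 2 ^ (j + 1) := by simp [hq]
        rw [hqR, Real.log_pow]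
        have hlog : Real.log 2 ≤ 1 := by
          have := Real.log_le_sub_one_of_pos (show (0 : ℝ) < 2 by norm_num)
          linarith
        have hj : (0 : ℝ) ≤ (j : ℝ) + 1 := by positivity
        have := mul_le_mul_of_nonneg_left hlog hj
        push_cast
        linarith

/-- Fourier inversion on `ℤ/2^{j+1}`: `w_j(d) = Σ_{r<q} c_r e(d r/q)` for every `d : ℕ`
(orthogonality of the additive characters and `q`-periodicity of `w_j`). [folklore] -/
theorem expansion (j : ℕ) (c : ℕ → ℂ)
    (hc : ∀ r, c r = 1 / (2 ^ (j + 1) : ℂ) * ∑ x ∈ range (2 ^ (j + 1)),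
      ((walshSign j x : ℝ) : ℂ) * (𝐞 (-((x : ℝ) * ((r : ℝ) / 2 ^ (j + 1)))) : ℂ)) (d : ℕ) :
    ((walshSign j d : ℝ) : ℂ) =
      ∑ r ∈ range (2 ^ (j + 1)), c r * (𝐞 ((d : ℝ) * ((r : ℝ) / 2 ^ (j + 1))) : ℂ) := by
  obtain ⟨q, hq⟩ : ∃ q : ℕ, q = 2 ^ (j + 1) := ⟨_, rfl⟩
  have hq0 : q ≠ 0 := by rw [hq]; positivity
  have hqR : (q : ℝ) = 2 ^ (j + 1) := by simp [hq]
  have hqC : (q : ℂ) = 2 ^ (j + 1) := by simp [hq]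
  have hQC : (2 ^ (j + 1) : ℂ) ≠ 0 := pow_ne_zero _ two_ne_zero
  rw [← hq]
  have h1 : ∀ r ∈ range q, c r * (𝐞 ((d : ℝ) * ((r : ℝ) / 2 ^ (j + 1))) : ℂ) =
      1 / (2 ^ (j + 1) : ℂ) * ∑ x ∈ range q, ((walshSign j x : ℝ) : ℂ) *
        (𝐞 ((r : ℝ) * (((d : ℤ) - (x : ℤ) : ℤ) : ℝ) / q) : ℂ) := by
    intro r _
    rw [hc, ← hq, mul_assoc, Finset.sum_mul]
    congr 1
    refine Finset.sum_congr rfl fun x _ => ?_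
    have : -((x : ℝ) * ((r : ℝ) / 2 ^ (j + 1))) + (d : ℝ) * ((r : ℝ) / 2 ^ (j + 1)) =
        (r : ℝ) * (((d : ℤ) - (x : ℤ) : ℤ) : ℝ) / q := by
      rw [hqR]; push_cast; ring
    rw [mul_assoc, ← Circle.coe_mul, ← AddChar.map_add_eq_mul, this]
  rw [Finset.sum_congr rfl h1, ← Finset.mul_sum, Finset.sum_comm]
  simp_rw [← Finset.mul_sum, sum_range_fourierChar_div hq0]
  have hmem : d % q ∈ range q := mem_range.mpr (Nat.mod_lt d (Nat.pos_of_ne_zero hq0))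
  rw [Finset.sum_eq_single_of_mem (d % q) hmem ?_]
  · have hdvd : (q : ℤ) ∣ (d : ℤ) - ((d % q : ℕ) : ℤ) := by
      rw [Int.natCast_mod]
      exact (Int.mod_modEq _ _).dvd
    have hw : walshSign j (d % q) = walshSign j d := by rw [hq]; exact walshSign_mod j d
    rw [if_pos hdvd, hw, hqC, mul_comm ((walshSign j d : ℝ) : ℂ), ← mul_assoc,
      one_div_mul_cancel hQC, one_mul]
  · intro x hx hne
    rw [if_neg, mul_zero]
    intro hdvd
    apply hne
    have h1 : (x : ℤ) ≡ (d : ℤ) [ZMOD (q : ℤ)] := Int.modEq_iff_dvd.mpr hdvd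
    have h2 : x ≡ d [MOD q] := Int.natCast_modEq_iff.mp h1
    unfold Nat.ModEq at h2
    rwa [Nat.mod_eq_of_lt (mem_range.mp hx)] at h2

end StubFourier

/-- **Stub (square-wave Fourier expansion).** There is an absolute `A` such that for every `j` the
digit sign `(−1)^{bit_j d}` is a linear combination of the characters `d ↦ e(d·r/2^{j+1})`, `r` odd,
`r < 2^{j+1}`, with coefficients of total mass `≤ A·(j+1)`. Here `A = 4` and
`c_r = 2^{-(j+1)} Σ_{x<2^{j+1}} (−1)^{bit_j x} e(−x r/2^{j+1})`. [folklore] -/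
theorem stub_fourier :
    ∃ A : ℝ, ∀ j : ℕ, ∃ c : ℕ → ℂ,
      (∑ r ∈ Finset.range (2 ^ (j + 1)), ‖c r‖) ≤ A * (j + 1) ∧
      (∀ r, ¬ Odd r → c r = 0) ∧
      ∀ d : ℕ, ((walshSign j d : ℝ) : ℂ) =
        ∑ r ∈ Finset.range (2 ^ (j + 1)), c r * (𝐞 ((d : ℝ) * ((r : ℝ) / 2 ^ (j + 1))) : ℂ) := by
  refine ⟨4, fun j => ?_⟩
  obtain ⟨c, hc⟩ : ∃ c : ℕ → ℂ, ∀ r, c r = 1 / (2 ^ (j + 1) : ℂ) * ∑ x ∈ range (2 ^ (j + 1)),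
      ((walshSign j x : ℝ) : ℂ) * (𝐞 (-((x : ℝ) * ((r : ℝ) / 2 ^ (j + 1)))) : ℂ) :=
    ⟨fun r => 1 / (2 ^ (j + 1) : ℂ) * ∑ x ∈ range (2 ^ (j + 1)),
      ((walshSign j x : ℝ) : ℂ) * (𝐞 (-((x : ℝ) * ((r : ℝ) / 2 ^ (j + 1)))) : ℂ), fun _ => rfl⟩
  exact ⟨c, StubFourier.mass_le j c hc, fun r hr => StubFourier.coef_eq_zero j c hc hr,
    fun d => StubFourier.expansion j c hc d⟩

end Summit.QuantumAdvantage.DigitRung.Sketch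

end
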